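import Summits.QuantumFields.YangMills.Theorems.SwapVirialDeficitBlowUpGnomonicBaseFlat
import Summits.QuantumFields.YangMills.Theorems.SwapVirialDeficitBlowUpChartDeficitGrowth
import Summits.QuantumFields.YangMills.Theorems.SwapVirialDeficitZeroModeGroupThreeBall
import HarnessLib

/-!
# THE COMMUTATOR STIFFNESS FLOOR IN GNOMONIC LETTERS: `|η_x × η_y|² / (450·L⁶·(1+|η_x|²)(1+|η_y|²)) ≤ F̂(a, ε, η)` — the RELATIVE-ROTATION floor
# `|y₀u − x₀v|²/(450L⁶(1+x₀²+|u|²)(1+y₀²+|v|²))` on the fibre over the base point `(x₀, y₀)` (free-hands support of ⟨stmt-QuantumFields-24197⟩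
# `SwapVirialDeficit.SwapGluedStiffness`; the anisotropic half of stub S3∕S4 «finiteness and tails of the bottom measure» of fcl-p3 g47's sector skeleton)

w3 g65's hub-stiffness floor ✓`leadersW_hubStiff_le` weights the transverse letters `x_⊥ = u`, `y_⊥ = v` by `sin²2ψ`, `sin²ψ` of the hub — both vanish at the tip
`ψ → 0`, so the resulting bound `𝔪 ≲ ρ/(κ_xκ_y)` on the Morse–Bott density is NOT integrable against the cone law (`≍ ψ²dψ`) there.  The missing stiffness is the
COMMUTATOR relation `[C₀, C₂]` (✓`comm_frobNorm_sq_le_chartDeficit`: `‖[C₀,C₂]‖²_F ≤ 3600L⁶·F̂`), which does not see the hub at all: for quaternions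
`‖xy − yx‖² = 4|x⃗ × y⃗|²` (✓`ToronLog.norm_comm_sq`), so for the gnomonic letters `x = ±(1, η_x)`, `y = ±(1, η_y)`: `‖[C₀,C₂]‖²_F = 2‖x̂ŷ − ŷx̂‖² = 8|η_x × η_y|²/((1+|η_x|²)(1+|η_y|²))` (§2),
hence (§3) ★★ `gnoDeficit_one_ge_cross`: `|η_x × η_y|²/(450·L⁶(1+|η_x|²)(1+|η_y|²)) ≤ gnoDeficit 0 1 a ε η` for EVERY hub, every sign pattern, ALL coordinates, and
(§4) at the fibre point `η₀(x₀,y₀) + ξ(w)` (`η_x = (x₀,u)`, `η_y = (y₀,v)`): `|η_x × η_y|² ≥ |y₀u − x₀v|²`, ★★ `gnoDeficit_one_ge_relRot` — the relative rotation of the two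
axial letters is stiff with constant `(x₀² + y₀²)`-type, uniformly in the hub angle (it degenerates only at the apex `x₀ = y₀ = 0`).  Together with the hub floor
this is the 4-soft-directions structure `det_soft ≍ ψ⁴(ψ² + x₀² + y₀²)²` behind LEAD g97's «transversal codimension 4 = radial exponent» finiteness count.

HONEST LABEL: algebra on landed inequalities; S3∕S4∕S5, ⟨24197⟩ (window-uniform) ∕ ⟨24194⟩ ∕ ⟨24497⟩ OPEN; own crux ⟨22884⟩ OPEN (blocked-on ⟨19935⟩); no crux, rung of
record or summit is proved; the Yang–Mills mass gap is NOT proved; no summit is proved by a line.  THEOREMS ONLY (0 `def`, 0 `sorry`), standard axioms.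
Width seat ym-line-sfw-p2-w3 g66 (cell ym-idea-1, free hands), `--supports stmt-QuantumFields-24197`.  References: [cite: Luscher1983, §2]; [folklore].
-/

set_option autoImplicit false

noncomputable section

open MeasureTheory Quaternion
open scoped BigOperators Quaternion
open Literature.MathematicalPhysics.QuantumFieldTheory hiding SU2
open Literature.MathematicalPhysics.QuantumLattice
open Literature.Analysis.Calculus (radialUnit radialUnit_def norm_radialUnit)
open Literature.MathematicalPhysics.QuantumFieldTheory.Balaban1983to89.T4WilsonGaugeFlatDirection (su2Quat_injective)

namespace Summit.QuantumFields.YangMills.Theorems.SwapVirialDeficit.BlowUpRing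

open Summit.QuantumFields.YangMills.Theorems.FemtoTransferGap
open Summit.QuantumFields.YangMills.Theorems.FemtoTransferGap.TT
open Summit.QuantumFields.YangMills.Theorems.FemtoTransferGap.TwoLattice.Flat (fd)
open Summit.QuantumFields.YangMills.Theorems.VirialFluxGap.RingDeficit
open Summit.QuantumFields.YangMills.Theorems.SwapVirialDeficit.SwapRing
open Summit.QuantumFields.YangMills.Theorems.SwapVirialDeficit.ZeroModeSigma (su2Quat_quatToSU2_eq_radialUnit)
open Summit.QuantumFields.YangMills.Theorems.SwapTwistDeficit.ToronLog (norm_comm_sq)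
open Summit.QuantumFields.YangMills.Theorems.SwapVirialDeficit.ZeroModeGroup (commSq commSq_def norm_comm_su2Quat_quatToSU2_sq)
open Summit.QuantumFields.YangMills.Theorems.SwapVirialDeficit.Gnomonic (normSq3 normSq3_nonneg)
open Summit.QuantumFields.YangMills.Theorems.ToronValleyVolume.Lojasiewicz (fd_sq_eq_two_mul)

variable {L : ℕ} [NeZero L]

/-! ## §1 The quaternion commutator is twice the cross product: ✓`SwapTwistDeficit.ToronLog.norm_comm_sq` (`‖zw − wz‖² = 4|Im z × Im w|²`) -/

/-! ## §2 The gnomonic letters: norm and commutator -/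

omit [NeZero L] in
/-- Components of a gnomonic letter: `gnoLetter ε v = ±(1, v₀, v₁, v₂)`. [folklore] -/
theorem gnoLetter_im (ε : Bool) (v : Fin 3 → ℝ) :
    (gnoLetter ε v).imI = gnoSign ε * v 0 ∧ (gnoLetter ε v).imJ = gnoSign ε * v 1 ∧ (gnoLetter ε v).imK = gnoSign ε * v 2 := by
  rw [gnoLetter_eq]
  exact ⟨by simp [gnomonicQuat], by simp [gnomonicQuat], by simp [gnomonicQuat]⟩

omit [NeZero L] in
/-- `‖±(1, v)‖² = 1 + |v|²`. [folklore] -/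
theorem norm_sq_gnoLetter (ε : Bool) (v : Fin 3 → ℝ) : ‖gnoLetter ε v‖ ^ 2 = 1 + normSq3 v := by
  obtain ⟨hI, hJ, hK⟩ := gnoLetter_im ε v
  rw [sq, ← Quaternion.normSq_eq_norm_mul_self, Quaternion.normSq_def', gnoLetter_re, hI, hJ, hK, normSq3, Fin.sum_univ_three]
  have hs : gnoSign ε ^ 2 = 1 := gnoSign_sq ε
  nlinarith [hs]

omit [NeZero L] in
/-- ★ **The normalised commutator of two gnomonic letters is the cross product of their coordinates**:
`commSq (±(1,v)) (±(1,w)) = 4|v × w|²/((1+|v|²)(1+|w|²))` (signs drop out). [folklore] -/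
theorem commSq_gnoLetter (εx εy : Bool) (v w : Fin 3 → ℝ) :
    commSq (gnoLetter εx v) (gnoLetter εy w) =
      4 * ((v 1 * w 2 - v 2 * w 1) ^ 2 + (v 2 * w 0 - v 0 * w 2) ^ 2 + (v 0 * w 1 - v 1 * w 0) ^ 2) / ((1 + normSq3 v) * (1 + normSq3 w)) := by
  rw [commSq_def, norm_comm_sq, norm_sq_gnoLetter, norm_sq_gnoLetter]
  obtain ⟨hI, hJ, hK⟩ := gnoLetter_im εx v
  obtain ⟨hI', hJ', hK'⟩ := gnoLetter_im εy w
  rw [hI, hJ, hK, hI', hJ', hK']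
  have hs : gnoSign εx ^ 2 = 1 := gnoSign_sq εx
  have hs' : gnoSign εy ^ 2 = 1 := gnoSign_sq εy
  congr 1
  have e : ∀ a b c d : ℝ, (gnoSign εx * a * (gnoSign εy * b) - gnoSign εx * c * (gnoSign εy * d)) ^ 2 = (a * b - c * d) ^ 2 := by
    intro a b c d
    have : (gnoSign εx * a * (gnoSign εy * b) - gnoSign εx * c * (gnoSign εy * d)) ^ 2 = gnoSign εx ^ 2 * gnoSign εy ^ 2 * (a * b - c * d) ^ 2 := by ring
    rw [this, hs, hs', one_mul, one_mul]
  rw [e, e, e]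

/-! ## §3 The commutator floor at every gnomonic chart point -/

omit [NeZero L] in
/-- ★ The Frobenius norm of `[C₀, C₂]` at a gnomonic chart point: `‖C₀C₂ − C₂C₀‖²_F = 2·commSq(x, y)` with `x = gnoLetter ε_x η_x`, `y = gnoLetter ε_y η_y`
(✓`fd_sq_eq_two_mul`, ✓`su2Quat_mul`, ✓`norm_comm_su2Quat_quatToSU2_sq`). [folklore] -/
theorem frobNorm_comm_zero_two_sq (a : ℍ) (ε : GnoSign L) (η : GnoCoord L) :
    frobNorm ((((blowUpPoint (L := L) 1 (gnomonicPoint a ε η)).1 0 * (blowUpPoint (L := L) 1 (gnomonicPoint a ε η)).1 2 : SU2) : Matrix (Fin 2) (Fin 2) ℂ) -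
        (((blowUpPoint (L := L) 1 (gnomonicPoint a ε η)).1 2 * (blowUpPoint (L := L) 1 (gnomonicPoint a ε η)).1 0 : SU2) : Matrix (Fin 2) (Fin 2) ℂ)) ^ 2 =
      2 * commSq (gnoLetter ε.1.1 η.1.1) (gnoLetter ε.1.2 η.1.2) := by
  set q := blowUpPoint (L := L) 1 (gnomonicPoint a ε η) with hq
  have h0 : q.1 0 = quatToSU2 (gnoLetter ε.1.1 η.1.1) := by
    show BlowUp.leaderTuple a (ZeroModeSigma.dil3 1 (gnomonicPoint a ε η).2.1) 0 = _
    rw [(BlowUp.leaderTuple_apply _ _).1, BlowUp.dil3_one']; rfl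
  have h2 : q.1 2 = quatToSU2 (gnoLetter ε.1.2 η.1.2) := by
    show BlowUp.leaderTuple a (ZeroModeSigma.dil3 1 (gnomonicPoint a ε η).2.1) 2 = _
    rw [(BlowUp.leaderTuple_apply _ _).2.2.1, BlowUp.dil3_one']; rfl
  have hfd : frobNorm (((q.1 0 * q.1 2 : SU2) : Matrix (Fin 2) (Fin 2) ℂ) - ((q.1 2 * q.1 0 : SU2) : Matrix (Fin 2) (Fin 2) ℂ)) = fd (q.1 0 * q.1 2) (q.1 2 * q.1 0) := by
    simp only [fd]
  rw [hfd, fd_sq_eq_two_mul, Balaban1983to89.T4HaarSU2Translate.su2Quat_mul, Balaban1983to89.T4HaarSU2Translate.su2Quat_mul, h0, h2,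
    norm_comm_su2Quat_quatToSU2_sq (gnoLetter_ne_zero _ _) (gnoLetter_ne_zero _ _)]

/-- ★★ **THE COMMUTATOR STIFFNESS FLOOR** (principal sector): for EVERY hub `a`, every sign pattern and ALL gnomonic coordinates,
`|η_x × η_y|² / (450·L⁶·(1+|η_x|²)(1+|η_y|²)) ≤ gnoDeficit 0 1 a ε η` (✓`chartDeficit_ge_of_comm_far` with `R = ‖[C₀,C₂]‖_F`). [cite: Luscher1983, §2] -/
theorem gnoDeficit_one_ge_cross (a : ℍ) (ε : GnoSign L) (η : GnoCoord L) :
    ((η.1.1 1 * η.1.2 2 - η.1.1 2 * η.1.2 1) ^ 2 + (η.1.1 2 * η.1.2 0 - η.1.1 0 * η.1.2 2) ^ 2 + (η.1.1 0 * η.1.2 1 - η.1.1 1 * η.1.2 0) ^ 2) /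
        (450 * (L : ℝ) ^ 6 * ((1 + normSq3 η.1.1) * (1 + normSq3 η.1.2))) ≤
      gnoDeficit (fun _ => false) (fun _ => 1) a ε η := by
  set q := blowUpPoint (L := L) 1 (gnomonicPoint a ε η) with hq
  have hL : (0 : ℝ) < L := by exact_mod_cast NeZero.pos L
  have h := chartDeficit_ge_of_comm_far (L := L) q 0 2 (frobNorm_nonneg _) le_rfl
  have e : (Fin.castSucc (0 : Fin 3) : Fin 4) = 0 := rfl
  have e2 : (Fin.castSucc (2 : Fin 3) : Fin 4) = 2 := rfl
  rw [e, e2, hq, frobNorm_comm_zero_two_sq a ε η, commSq_gnoLetter] at h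
  unfold gnoDeficit
  have hden : 0 < (1 + normSq3 η.1.1) * (1 + normSq3 η.1.2) := by
    have := normSq3_nonneg η.1.1; have := normSq3_nonneg η.1.2; positivity
  calc _ = 2 * (4 * ((η.1.1 1 * η.1.2 2 - η.1.1 2 * η.1.2 1) ^ 2 + (η.1.1 2 * η.1.2 0 - η.1.1 0 * η.1.2 2) ^ 2 +
        (η.1.1 0 * η.1.2 1 - η.1.1 1 * η.1.2 0) ^ 2) / ((1 + normSq3 η.1.1) * (1 + normSq3 η.1.2))) / (3600 * (L : ℝ) ^ 6) := by
        field_simp; ring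
    _ ≤ _ := h

/-! ## §4 The relative-rotation floor on the fibre over `(x₀, y₀)` -/

/-- ★★ **THE RELATIVE-ROTATION FLOOR on the fibre over the base point `(x₀, y₀)`** (every hub, every sign pattern, every fibre point — no smallness):
`|y₀u − x₀v|² / (450·L⁶·(1 + x₀² + |u|²)(1 + y₀² + |v|²)) ≤ F̂(η₀(x₀,y₀) + ξ(w))` — the stiffness of the relative rotation of the two axial letters, uniform in the
hub angle, degenerating only at the apex `x₀ = y₀ = 0` (complements the hub floor ✓`leadersW_hubStiff_le`, which carries `sin²2ψ|u|²`, `sin²ψ|v|²`). [cite: Luscher1983, §2] -/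
theorem gnoDeficit_one_ge_relRot (a : ℍ) (ε : GnoSign L) (x₀ y₀ : ℝ) (w : ((Fin 2 → ℝ) × (Fin 2 → ℝ)) × (Fin 3 → ℝ) × (Fol L → Fin 3 → ℝ)) :
    ((y₀ * w.1.1 0 - x₀ * w.1.2 0) ^ 2 + (y₀ * w.1.1 1 - x₀ * w.1.2 1) ^ 2) /
        (450 * (L : ℝ) ^ 6 * ((1 + (x₀ ^ 2 + (w.1.1 0 ^ 2 + w.1.1 1 ^ 2))) * (1 + (y₀ ^ 2 + (w.1.2 0 ^ 2 + w.1.2 1 ^ 2))))) ≤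
      gnoDeficit (fun _ => false) (fun _ => 1) a ε
        (((((![x₀, 0, 0] : Fin 3 → ℝ), (![y₀, 0, 0] : Fin 3 → ℝ)), ((0 : Fin 3 → ℝ), (0 : Fol L → Fin 3 → ℝ))) : GnoCoord L) +
          (((![0, w.1.1 0, w.1.1 1] : Fin 3 → ℝ), (![0, w.1.2 0, w.1.2 1] : Fin 3 → ℝ)), (w.2.1, w.2.2))) := by
  have h := gnoDeficit_one_ge_cross (L := L) a ε
    (((((![x₀, 0, 0] : Fin 3 → ℝ), (![y₀, 0, 0] : Fin 3 → ℝ)), ((0 : Fin 3 → ℝ), (0 : Fol L → Fin 3 → ℝ))) : GnoCoord L) +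
      (((![0, w.1.1 0, w.1.1 1] : Fin 3 → ℝ), (![0, w.1.2 0, w.1.2 1] : Fin 3 → ℝ)), (w.2.1, w.2.2)))
  simp only [Prod.fst_add, Prod.snd_add, Pi.add_apply, normSq3, Fin.sum_univ_three, Matrix.cons_val_zero, Matrix.cons_val_one,
    Matrix.cons_val_two, Matrix.head_cons, Matrix.tail_cons, add_zero, zero_add] at h
  have hL : (0 : ℝ) < L := by exact_mod_cast NeZero.pos L
  have hden : 0 < 450 * (L : ℝ) ^ 6 * ((1 + (x₀ ^ 2 + (w.1.1 0 ^ 2 + w.1.1 1 ^ 2))) * (1 + (y₀ ^ 2 + (w.1.2 0 ^ 2 + w.1.2 1 ^ 2)))) := by positivity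
  refine le_trans ?_ h
  have eden : 450 * (L : ℝ) ^ 6 * ((1 + (x₀ ^ 2 + w.1.1 0 ^ 2 + w.1.1 1 ^ 2)) * (1 + (y₀ ^ 2 + w.1.2 0 ^ 2 + w.1.2 1 ^ 2))) =
      450 * (L : ℝ) ^ 6 * ((1 + (x₀ ^ 2 + (w.1.1 0 ^ 2 + w.1.1 1 ^ 2))) * (1 + (y₀ ^ 2 + (w.1.2 0 ^ 2 + w.1.2 1 ^ 2)))) := by ring
  rw [eden]
  apply div_le_div_of_nonneg_right _ hden.le
  nlinarith [sq_nonneg (w.1.1 0 * w.1.2 1 - w.1.1 1 * w.1.2 0)]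

end Summit.QuantumFields.YangMills.Theorems.SwapVirialDeficit.BlowUpRing

end
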